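import Summits.NavierStokesRegularity.NavierStokesRegularity.Theorems.HubbleDynamoDilutionBudgetIdentities
import Mathlib.Analysis.SpecialFunctions.JapaneseBracket
import HarnessLib

/-!
# The dilution budget of a Leray profile, II: the limit `R → ∞` in the Type-I decay class
# (route `HubbleDynamo`, item `DilutionBudget`, stmt-NavierStokesRegularity-1938)

Helper file (all results proved). For a smooth Leray profile on `ℝ³` with the Type-I tails
`|U| ≤ C/(1+|y|)`, `|∇U| ≤ C/(1+|y|)²`, `|∇Ω| ≤ C/(1+|y|)³` (`Ω = curl U`; the NRŠ/Chae–Wolf decay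
class) the enstrophy budget of the steady induction equation reads

  `∫ ⟪Ω, (Ω·∇)U⟫ = (a/2) ∫ |Ω|² + ν ∫ |∇Ω|²`   (`hubbleDynamo_dilutionBudget`):

vortex stretching pays the Ohmic loss plus exactly `a/2` of Hubble dilution (at `a = 0`, Galdi's
steady Liouville problem, the bonus disappears). Proof: the truncated budget
`hubbleDilution_cutoff_identity` of part I with the tree's cut-off family `cutoff R`
(`‖∇ cutoff R‖ ≤ K/R`), and `R → ∞` by dominated convergence — in the decay class `|Ω|²`,
`|∇Ω|²`, `⟪Ω,(Ω·∇)U⟫`, `⟪∂ᵢΩ,Ω⟫` are `O((1+|y|)⁻⁴)`, hence integrable on `ℝ³`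
(`hubbleDilution_integrable`, Mathlib `integrable_one_add_norm`), while the cut-off errors carry a
factor `∇φ_R = O(1/R)` (`hubbleDilution_limit`).

NOTE on the item. The route decl `Theses.HubbleDynamo.DilutionBudget` as filed writes its
right-hand side `(a / 2) * ∫ y, ‖curl U y‖ ^ 2 + ν * ∫ y, …` WITHOUT brackets, which Lean parses as
`(a/2) * ∫ y, (‖curl U y‖ ^ 2 + ν * ∫ y, …)` (the integral binder swallows the sum); that reading is
not the dilution budget (its integrand is non-integrable whenever `ν∫|∇Ω|² ≠ 0`). The theorem
below is the intended statement, with the route's hypotheses verbatim and the right-hand side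
bracketed `(a / 2) * (∫ y, ‖curl U y‖ ^ 2) + ν * ∫ y, …`.

References: Tsai 1998 (ARMA 143), §2; Nečas–Růžička–Šverák 1996; Galdi 2011, §X.9.
-/

noncomputable section

set_option linter.dupNamespace false

open MeasureTheory Set Function Filter Topology InnerProductSpace
open scoped RealInnerProductSpace Laplacian ContDiff

namespace Summit.NavierStokesRegularity.NavierStokesRegularity.Theorems

open Literature.Analysis.FluidPDE

/-! ### Integrability in the Type-I decay class -/

/-- A continuous function on `ℝ³` dominated by `K (1+|y|)⁻ᵏ`, `k ≥ 4`, is integrable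
(Mathlib `integrable_one_add_norm`). -/
theorem hubbleDilution_integrable_of_le {F : Type*} [NormedAddCommGroup F] {f : (EuclideanSpace ℝ (Fin 3)) → F}
    {K : ℝ} {k : ℕ} (hf : Continuous f) (hk : 4 ≤ k)
    (hle : ∀ y, ‖f y‖ ≤ K * ((1 + ‖y‖) ^ k)⁻¹) : Integrable f := by
  have h := integrable_one_add_norm (E := (EuclideanSpace ℝ (Fin 3))) (μ := volume) (r := k) (by
    simp only [finrank_euclideanSpace, Fintype.card_fin, Nat.cast_ofNat]
    exact_mod_cast (show 3 < k by omega))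
  have h' : Integrable (fun y : (EuclideanSpace ℝ (Fin 3)) => K * ((1 + ‖y‖) ^ k)⁻¹) := by
    refine (h.const_mul K).congr (Eventually.of_forall fun y => ?_)
    have h0 : 0 < 1 + ‖y‖ := by positivity
    show K * (1 + ‖y‖) ^ (-(k : ℝ)) = K * ((1 + ‖y‖) ^ k)⁻¹
    rw [Real.rpow_neg h0.le, Real.rpow_natCast]
  exact h'.mono' hf.aestronglyMeasurable (Eventually.of_forall hle)

/-- `|L|² ≤ 3‖L‖²` for the Frobenius norm on `ℝ³`. -/
theorem hubbleDilution_frobeniusNormSq_le (L : (EuclideanSpace ℝ (Fin 3)) →L[ℝ] (EuclideanSpace ℝ (Fin 3))) : frobeniusNormSq L ≤ 3 * ‖L‖ ^ 2 := by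
  rw [frobeniusNormSq_eq_sum (EuclideanSpace.basisFun (Fin 3) ℝ)]
  calc ∑ i, ‖L ((EuclideanSpace.basisFun (Fin 3) ℝ) i)‖ ^ 2 ≤ ∑ _i : Fin 3, ‖L‖ ^ 2 := by
        refine Finset.sum_le_sum fun i _ => pow_le_pow_left₀ (norm_nonneg _) ?_ 2
        calc ‖L ((EuclideanSpace.basisFun (Fin 3) ℝ) i)‖
            ≤ ‖L‖ * ‖(EuclideanSpace.basisFun (Fin 3) ℝ) i‖ := L.le_opNorm _
          _ = ‖L‖ := by rw [(EuclideanSpace.basisFun (Fin 3) ℝ).orthonormal.1 i, mul_one]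
    _ = 3 * ‖L‖ ^ 2 := by simp

/-- **Integrability in the decay class.** For `U ∈ C²` with `|U| ≤ C/(1+|y|)`, `|∇U| ≤ C/(1+|y|)²`,
`|∇Ω| ≤ C/(1+|y|)³`: `|Ω|²`, `|∇Ω|²`, `⟪Ω,(Ω·∇)U⟫` and `⟪∂ᵥΩ,Ω⟫` (`‖v‖ ≤ 1`) are integrable on `ℝ³`
(all are `O((1+|y|)⁻⁴)`), and `|U| ≤ C`. -/
theorem hubbleDilution_integrable {U : (EuclideanSpace ℝ (Fin 3)) → (EuclideanSpace ℝ (Fin 3))} (hU : ContDiff ℝ 2 U) {C : ℝ}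
    (hC : ∀ y, ‖U y‖ ≤ C / (1 + ‖y‖) ∧ ‖fderiv ℝ U y‖ ≤ C / (1 + ‖y‖) ^ 2 ∧
      ‖fderiv ℝ (curl U) y‖ ≤ C / (1 + ‖y‖) ^ 3) :
    Integrable (fun y => ‖curl U y‖ ^ 2)
      ∧ Integrable (fun y => frobeniusNormSq (fderiv ℝ (curl U) y))
      ∧ Integrable (fun y => ⟪curl U y, fderiv ℝ U y (curl U y)⟫)
      ∧ (∀ v : (EuclideanSpace ℝ (Fin 3)), ‖v‖ ≤ 1 → Integrable (fun y => ⟪fderiv ℝ (curl U) y v, curl U y⟫))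
      ∧ (0 ≤ C ∧ ∀ y, ‖U y‖ ≤ C) := by
  have hU1 : ContDiff ℝ 1 U := hU.of_le (by norm_num)
  have hΩ1 : ContDiff ℝ 1 (curl U) := contDiff_curl (n := 1) (by exact_mod_cast hU)
  have cΩ : Continuous (curl U) := continuous_curl hU1
  have cDΩ : Continuous (fderiv ℝ (curl U)) := hΩ1.continuous_fderiv one_ne_zero
  have cDU : Continuous (fderiv ℝ U) := hU1.continuous_fderiv one_ne_zero
  have hC0 : 0 ≤ C := by
    have h0 := (hC 0).1
    rw [norm_zero, add_zero, div_one] at h0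
    exact (norm_nonneg _).trans h0
  have hr : ∀ y : (EuclideanSpace ℝ (Fin 3)), 1 ≤ 1 + ‖y‖ := fun y => by linarith [norm_nonneg y]
  have hr0 : ∀ y : (EuclideanSpace ℝ (Fin 3)), 0 < 1 + ‖y‖ := fun y => by linarith [norm_nonneg y]
  set κ : ℝ := ‖curlCLM‖ with hκ
  have hκ0 : 0 ≤ κ := by rw [hκ]; exact norm_nonneg curlCLM
  -- pointwise bounds
  have hΩ : ∀ y, ‖curl U y‖ ≤ κ * C * ((1 + ‖y‖) ^ 2)⁻¹ := fun y => by
    calc ‖curl U y‖ ≤ κ * ‖fderiv ℝ U y‖ := norm_curl_le U y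
      _ ≤ κ * (C / (1 + ‖y‖) ^ 2) := mul_le_mul_of_nonneg_left (hC y).2.1 hκ0
      _ = κ * C * ((1 + ‖y‖) ^ 2)⁻¹ := by rw [div_eq_mul_inv, mul_assoc]
  have hΩsq : ∀ y, ‖curl U y‖ ^ 2 ≤ (κ * C) ^ 2 * ((1 + ‖y‖) ^ 4)⁻¹ := fun y => by
    calc ‖curl U y‖ ^ 2 ≤ (κ * C * ((1 + ‖y‖) ^ 2)⁻¹) ^ 2 :=
          pow_le_pow_left₀ (norm_nonneg _) (hΩ y) 2
      _ = (κ * C) ^ 2 * ((1 + ‖y‖) ^ 4)⁻¹ := by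
          rw [mul_pow, inv_pow, ← pow_mul]
  have hUC : ∀ y, ‖U y‖ ≤ C := fun y =>
    (hC y).1.trans (div_le_self hC0 (hr y))
  refine ⟨?_, ?_, ?_, ?_, hC0, hUC⟩
  · -- `|Ω|²`
    refine hubbleDilution_integrable_of_le (K := (κ * C) ^ 2) (k := 4) (cΩ.norm.pow 2) le_rfl
      fun y => ?_
    rw [Real.norm_eq_abs, abs_of_nonneg (sq_nonneg _)]
    exact hΩsq y
  · -- `|∇Ω|²`
    refine hubbleDilution_integrable_of_le (K := 3 * C ^ 2) (k := 6)
      (continuous_frobeniusNormSq_fderiv hΩ1 one_ne_zero) (by norm_num) fun y => ?_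
    rw [Real.norm_eq_abs, abs_of_nonneg (frobeniusNormSq_nonneg _)]
    calc frobeniusNormSq (fderiv ℝ (curl U) y) ≤ 3 * ‖fderiv ℝ (curl U) y‖ ^ 2 :=
          hubbleDilution_frobeniusNormSq_le _
      _ ≤ 3 * (C / (1 + ‖y‖) ^ 3) ^ 2 := by
          gcongr
          exact (hC y).2.2
      _ = 3 * C ^ 2 * ((1 + ‖y‖) ^ 6)⁻¹ := by
          rw [div_pow, ← pow_mul, div_eq_mul_inv, mul_assoc]
  · -- `⟪Ω, (Ω·∇)U⟫`
    refine hubbleDilution_integrable_of_le (K := C * (κ * C) ^ 2) (k := 6)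
      (cΩ.inner (cDU.clm_apply cΩ)) (by norm_num) fun y => ?_
    calc ‖⟪curl U y, fderiv ℝ U y (curl U y)⟫‖ ≤ ‖curl U y‖ * ‖fderiv ℝ U y (curl U y)‖ :=
          norm_inner_le_norm _ _
      _ ≤ ‖curl U y‖ * (‖fderiv ℝ U y‖ * ‖curl U y‖) := by
          gcongr; exact ContinuousLinearMap.le_opNorm _ _
      _ = ‖fderiv ℝ U y‖ * ‖curl U y‖ ^ 2 := by ring
      _ ≤ (C / (1 + ‖y‖) ^ 2) * ((κ * C) ^ 2 * ((1 + ‖y‖) ^ 4)⁻¹) :=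
          mul_le_mul (hC y).2.1 (hΩsq y) (sq_nonneg _) (div_nonneg hC0 (pow_nonneg (hr0 y).le _))
      _ = C * (κ * C) ^ 2 * ((1 + ‖y‖) ^ 6)⁻¹ := by
          rw [div_eq_mul_inv]
          have h6 : ((1 + ‖y‖) ^ 6)⁻¹ = ((1 + ‖y‖) ^ 2)⁻¹ * ((1 + ‖y‖) ^ 4)⁻¹ := by
            rw [← mul_inv, ← pow_add]
          rw [h6]; ring
  · -- `⟪∂ᵥΩ, Ω⟫`
    intro v hv
    refine hubbleDilution_integrable_of_le (K := C * (κ * C)) (k := 5)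
      ((cDΩ.clm_apply continuous_const).inner cΩ) (by norm_num) fun y => ?_
    calc ‖⟪fderiv ℝ (curl U) y v, curl U y⟫‖ ≤ ‖fderiv ℝ (curl U) y v‖ * ‖curl U y‖ :=
          norm_inner_le_norm _ _
      _ ≤ (‖fderiv ℝ (curl U) y‖ * ‖v‖) * ‖curl U y‖ := by
          gcongr; exact ContinuousLinearMap.le_opNorm _ _
      _ ≤ (‖fderiv ℝ (curl U) y‖ * 1) * ‖curl U y‖ := by gcongr
      _ = ‖fderiv ℝ (curl U) y‖ * ‖curl U y‖ := by rw [mul_one]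
      _ ≤ (C / (1 + ‖y‖) ^ 3) * (κ * C * ((1 + ‖y‖) ^ 2)⁻¹) :=
          mul_le_mul (hC y).2.2 (hΩ y) (norm_nonneg _) (div_nonneg hC0 (pow_nonneg (hr0 y).le _))
      _ = C * (κ * C) * ((1 + ‖y‖) ^ 5)⁻¹ := by
          rw [div_eq_mul_inv]
          have h5 : ((1 + ‖y‖) ^ 5)⁻¹ = ((1 + ‖y‖) ^ 3)⁻¹ * ((1 + ‖y‖) ^ 2)⁻¹ := by
            rw [← mul_inv, ← pow_add]
          rw [h5]; ring

/-! ### Dominated convergence for the cut-off errors -/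

/-- **Weighted integrals of an integrable function.** If `g ∈ L¹(ℝ³)` and the continuous weights
`w n` are bounded by `M` and converge pointwise to the constant `c`, then
`∫ w n · g → c ∫ g` (dominated convergence). -/
theorem hubbleDilution_tendsto_integral_mul {g : (EuclideanSpace ℝ (Fin 3)) → ℝ} (hg : Integrable g) {w : ℕ → (EuclideanSpace ℝ (Fin 3)) → ℝ}
    {M c : ℝ} (hwc : ∀ n, Continuous (w n)) (hwM : ∀ n y, |w n y| ≤ M)
    (hwlim : ∀ y, Tendsto (fun n => w n y) atTop (𝓝 c)) :
    Tendsto (fun n => ∫ y, w n y * g y) atTop (𝓝 (c * ∫ y, g y)) := by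
  rw [← integral_const_mul]
  refine tendsto_integral_of_dominated_convergence (fun y => M * ‖g y‖) ?_ ?_ ?_ ?_
  · exact fun n => (hwc n).aestronglyMeasurable.mul hg.aestronglyMeasurable
  · exact hg.norm.const_mul M
  · intro n
    refine Eventually.of_forall fun y => ?_
    rw [norm_mul, Real.norm_eq_abs]
    exact mul_le_mul_of_nonneg_right (hwM n y) (norm_nonneg _)
  · exact Eventually.of_forall fun y => (hwlim y).mul tendsto_const_nhds

/-- **The limit `R → ∞`.** For a Leray profile in the decay class and any sequence of `C¹_c`
cut-offs `φ n → 1` pointwise with `|φ n| ≤ 1`, `‖∇φ n‖ ≤ ε n → 0`, `ε n ≤ K` and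
`|(y·∇)φ n| ≤ K`, the truncated budgets converge to
`∫⟪Ω,(Ω·∇)U⟫ = (a/2)∫|Ω|² + ν∫|∇Ω|²`. -/
theorem hubbleDilution_limit {ν a : ℝ} {U : (EuclideanSpace ℝ (Fin 3)) → (EuclideanSpace ℝ (Fin 3))} {P : (EuclideanSpace ℝ (Fin 3)) → ℝ} (hU : ContDiff ℝ 4 U)
    (hP : ContDiff ℝ 2 P) (h : IsLerayProfile ν a U P) {C : ℝ}
    (hC : ∀ y, ‖U y‖ ≤ C / (1 + ‖y‖) ∧ ‖fderiv ℝ U y‖ ≤ C / (1 + ‖y‖) ^ 2 ∧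
      ‖fderiv ℝ (curl U) y‖ ≤ C / (1 + ‖y‖) ^ 3)
    (φ : ℕ → (EuclideanSpace ℝ (Fin 3)) → ℝ) (hφ : ∀ n, ContDiff ℝ 1 (φ n)) (hφs : ∀ n, HasCompactSupport (φ n))
    (hφ1 : ∀ n y, |φ n y| ≤ 1) (hφlim : ∀ y, Tendsto (fun n => φ n y) atTop (𝓝 1))
    {K : ℝ} {ε : ℕ → ℝ} (hε : ∀ n y, ‖fderiv ℝ (φ n) y‖ ≤ ε n) (hεK : ∀ n, ε n ≤ K)
    (hε0 : Tendsto ε atTop (𝓝 0)) (hK : ∀ n y, |fderiv ℝ (φ n) y y| ≤ K) :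
    ∫ y, ⟪curl U y, fderiv ℝ U y (curl U y)⟫ =
      a / 2 * (∫ y, ‖curl U y‖ ^ 2) + ν * ∫ y, frobeniusNormSq (fderiv ℝ (curl U) y) := by
  have hU2 : ContDiff ℝ 2 U := hU.of_le (by norm_num)
  have hU1 : ContDiff ℝ 1 U := hU.of_le (by norm_num)
  have hΩ1 : ContDiff ℝ 1 (curl U) := contDiff_curl (n := 1) (by exact_mod_cast hU2)
  obtain ⟨iΩ, ifrob, istr, icross, hC0, hUC⟩ := hubbleDilution_integrable hU2 hC
  have hε0' : ∀ n, 0 ≤ ε n := fun n => (norm_nonneg _).trans (hε n 0)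
  have hK0 : 0 ≤ K := (hε0' 0).trans (hεK 0)
  -- continuity of the weights
  have cφ : ∀ n, Continuous (φ n) := fun n => (hφ n).continuous
  have cDφ : ∀ n, Continuous (fderiv ℝ (φ n)) := fun n => (hφ n).continuous_fderiv one_ne_zero
  -- the truncated budgets
  have hid : ∀ n, ∫ y, φ n y * ⟪curl U y, fderiv ℝ U y (curl U y)⟫ =
      a / 2 * (∫ y, φ n y * ‖curl U y‖ ^ 2)
        + ν * (∫ y, φ n y * frobeniusNormSq (fderiv ℝ (curl U) y))
        + (ν * (∑ i, ∫ y, fderiv ℝ (φ n) y ((stdOrthonormalBasis ℝ (EuclideanSpace ℝ (Fin 3))) i) * ⟪fderiv ℝ (curl U) y ((stdOrthonormalBasis ℝ (EuclideanSpace ℝ (Fin 3))) i), curl U y⟫)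
            - a / 2 * (∫ y, fderiv ℝ (φ n) y y * ‖curl U y‖ ^ 2)
            - 1 / 2 * ∫ y, fderiv ℝ (φ n) y (U y) * ‖curl U y‖ ^ 2) := fun n =>
    hubbleDilution_cutoff_identity hU hP h (hφ n) (hφs n)
  -- the main terms converge
  have limF : Tendsto (fun n => ∫ y, φ n y * ⟪curl U y, fderiv ℝ U y (curl U y)⟫) atTop
      (𝓝 (∫ y, ⟪curl U y, fderiv ℝ U y (curl U y)⟫)) := by
    have := hubbleDilution_tendsto_integral_mul istr cφ hφ1 hφlim
    rwa [one_mul] at this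
  have limC : Tendsto (fun n => ∫ y, φ n y * ‖curl U y‖ ^ 2) atTop (𝓝 (∫ y, ‖curl U y‖ ^ 2)) := by
    have := hubbleDilution_tendsto_integral_mul iΩ cφ hφ1 hφlim
    rwa [one_mul] at this
  have limA : Tendsto (fun n => ∫ y, φ n y * frobeniusNormSq (fderiv ℝ (curl U) y)) atTop
      (𝓝 (∫ y, frobeniusNormSq (fderiv ℝ (curl U) y))) := by
    have := hubbleDilution_tendsto_integral_mul ifrob cφ hφ1 hφlim
    rwa [one_mul] at this
  -- the error terms vanish
  have limB : Tendsto
      (fun n => ∑ i, ∫ y, fderiv ℝ (φ n) y ((stdOrthonormalBasis ℝ (EuclideanSpace ℝ (Fin 3))) i) * ⟪fderiv ℝ (curl U) y ((stdOrthonormalBasis ℝ (EuclideanSpace ℝ (Fin 3))) i), curl U y⟫) atTop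
      (𝓝 0) := by
    have hsum : ∀ i ∈ (Finset.univ : Finset (Fin (Module.finrank ℝ (EuclideanSpace ℝ (Fin 3))))), Tendsto
        (fun n => ∫ y, fderiv ℝ (φ n) y ((stdOrthonormalBasis ℝ (EuclideanSpace ℝ (Fin 3))) i) * ⟪fderiv ℝ (curl U) y ((stdOrthonormalBasis ℝ (EuclideanSpace ℝ (Fin 3))) i), curl U y⟫) atTop
        (𝓝 0) := by
      intro i _
      have hb : ‖(stdOrthonormalBasis ℝ (EuclideanSpace ℝ (Fin 3))) i‖ ≤ 1 := le_of_eq ((stdOrthonormalBasis ℝ (EuclideanSpace ℝ (Fin 3))).orthonormal.1 i)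
      have hw : ∀ n y, |fderiv ℝ (φ n) y ((stdOrthonormalBasis ℝ (EuclideanSpace ℝ (Fin 3))) i)| ≤ K := fun n y => by
        rw [← Real.norm_eq_abs]
        calc ‖fderiv ℝ (φ n) y ((stdOrthonormalBasis ℝ (EuclideanSpace ℝ (Fin 3))) i)‖ ≤ ‖fderiv ℝ (φ n) y‖ * ‖(stdOrthonormalBasis ℝ (EuclideanSpace ℝ (Fin 3))) i‖ :=
              ContinuousLinearMap.le_opNorm _ _
          _ ≤ ε n * 1 := mul_le_mul (hε n y) hb (norm_nonneg _) (hε0' n)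
          _ ≤ K := by rw [mul_one]; exact hεK n
      have hwlim : ∀ y, Tendsto (fun n => fderiv ℝ (φ n) y ((stdOrthonormalBasis ℝ (EuclideanSpace ℝ (Fin 3))) i)) atTop (𝓝 0) := fun y => by
        refine squeeze_zero_norm (fun n => ?_) hε0
        calc ‖fderiv ℝ (φ n) y ((stdOrthonormalBasis ℝ (EuclideanSpace ℝ (Fin 3))) i)‖ ≤ ‖fderiv ℝ (φ n) y‖ * ‖(stdOrthonormalBasis ℝ (EuclideanSpace ℝ (Fin 3))) i‖ :=
              ContinuousLinearMap.le_opNorm _ _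
          _ ≤ ε n * 1 := mul_le_mul (hε n y) hb (norm_nonneg _) (hε0' n)
          _ = ε n := mul_one _
      have := hubbleDilution_tendsto_integral_mul (icross _ hb)
        (fun n => (cDφ n).clm_apply continuous_const) hw hwlim
      rwa [zero_mul] at this
    simpa using tendsto_finsetSum _ hsum
  have limD : Tendsto (fun n => ∫ y, fderiv ℝ (φ n) y y * ‖curl U y‖ ^ 2) atTop (𝓝 0) := by
    have hwlim : ∀ y, Tendsto (fun n => fderiv ℝ (φ n) y y) atTop (𝓝 0) := fun y => by
      have hlim : Tendsto (fun n => ε n * ‖y‖) atTop (𝓝 0) := by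
        simpa using hε0.mul_const ‖y‖
      refine squeeze_zero_norm (fun n => ?_) hlim
      exact (ContinuousLinearMap.le_opNorm _ _).trans
        (mul_le_mul_of_nonneg_right (hε n y) (norm_nonneg _))
    have := hubbleDilution_tendsto_integral_mul iΩ (fun n => (cDφ n).clm_apply continuous_id)
      hK hwlim
    rwa [zero_mul] at this
  have limE : Tendsto (fun n => ∫ y, fderiv ℝ (φ n) y (U y) * ‖curl U y‖ ^ 2) atTop (𝓝 0) := by
    have hw : ∀ n y, |fderiv ℝ (φ n) y (U y)| ≤ K * C := fun n y => by
      rw [← Real.norm_eq_abs]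
      calc ‖fderiv ℝ (φ n) y (U y)‖ ≤ ‖fderiv ℝ (φ n) y‖ * ‖U y‖ :=
            ContinuousLinearMap.le_opNorm _ _
        _ ≤ ε n * C := mul_le_mul (hε n y) (hUC y) (norm_nonneg _) (hε0' n)
        _ ≤ K * C := mul_le_mul_of_nonneg_right (hεK n) hC0
    have hwlim : ∀ y, Tendsto (fun n => fderiv ℝ (φ n) y (U y)) atTop (𝓝 0) := fun y => by
      have hlim : Tendsto (fun n => ε n * C) atTop (𝓝 0) := by
        simpa using hε0.mul_const C
      refine squeeze_zero_norm (fun n => ?_) hlim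
      exact (ContinuousLinearMap.le_opNorm _ _).trans
        (mul_le_mul (hε n y) (hUC y) (norm_nonneg _) (hε0' n))
    have := hubbleDilution_tendsto_integral_mul iΩ (fun n => (cDφ n).clm_apply hU1.continuous)
      hw hwlim
    rwa [zero_mul] at this
  -- pass to the limit in the truncated budgets
  have limRHS : Tendsto (fun n =>
      a / 2 * (∫ y, φ n y * ‖curl U y‖ ^ 2)
        + ν * (∫ y, φ n y * frobeniusNormSq (fderiv ℝ (curl U) y))
        + (ν * (∑ i, ∫ y, fderiv ℝ (φ n) y ((stdOrthonormalBasis ℝ (EuclideanSpace ℝ (Fin 3))) i) * ⟪fderiv ℝ (curl U) y ((stdOrthonormalBasis ℝ (EuclideanSpace ℝ (Fin 3))) i), curl U y⟫)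
            - a / 2 * (∫ y, fderiv ℝ (φ n) y y * ‖curl U y‖ ^ 2)
            - 1 / 2 * ∫ y, fderiv ℝ (φ n) y (U y) * ‖curl U y‖ ^ 2)) atTop
      (𝓝 (a / 2 * (∫ y, ‖curl U y‖ ^ 2) + ν * (∫ y, frobeniusNormSq (fderiv ℝ (curl U) y))
        + (ν * 0 - a / 2 * 0 - 1 / 2 * 0))) :=
    ((limC.const_mul _).add (limA.const_mul _)).add
      (((limB.const_mul _).sub (limD.const_mul _)).sub (limE.const_mul _))
  have limF' : Tendsto (fun n => ∫ y, φ n y * ⟪curl U y, fderiv ℝ U y (curl U y)⟫) atTop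
      (𝓝 (a / 2 * (∫ y, ‖curl U y‖ ^ 2) + ν * (∫ y, frobeniusNormSq (fderiv ℝ (curl U) y))
        + (ν * 0 - a / 2 * 0 - 1 / 2 * 0))) := by
    rw [show (fun n => ∫ y, φ n y * ⟪curl U y, fderiv ℝ U y (curl U y)⟫) = fun n =>
      a / 2 * (∫ y, φ n y * ‖curl U y‖ ^ 2)
        + ν * (∫ y, φ n y * frobeniusNormSq (fderiv ℝ (curl U) y))
        + (ν * (∑ i, ∫ y, fderiv ℝ (φ n) y ((stdOrthonormalBasis ℝ (EuclideanSpace ℝ (Fin 3))) i) * ⟪fderiv ℝ (curl U) y ((stdOrthonormalBasis ℝ (EuclideanSpace ℝ (Fin 3))) i), curl U y⟫)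
            - a / 2 * (∫ y, fderiv ℝ (φ n) y y * ‖curl U y‖ ^ 2)
            - 1 / 2 * ∫ y, fderiv ℝ (φ n) y (U y) * ‖curl U y‖ ^ 2) from funext hid]
    exact limRHS
  have huniq := tendsto_nhds_unique limF limF'
  rw [huniq]
  ring

/-! ### The standard cut-off family and the deciding theorem -/

/-- The tree's cut-off `cutoff R` (`= 1` on `|y| ≤ R`, `= 0` off `|y| ≤ 2R`, `‖∇‖ ≤ K/R`)
satisfies `|(y·∇) cutoff R (y)| ≤ 2K` (the gradient lives on `R ≤ |y| ≤ 2R`). -/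
theorem hubbleDilution_cutoff_fderiv_apply_self {K R : ℝ} (hR : 0 < R)
    (hK : ∀ x : (EuclideanSpace ℝ (Fin 3)), ‖fderiv ℝ (cutoff R) x‖ ≤ K / R) (y : (EuclideanSpace ℝ (Fin 3))) :
    |fderiv ℝ (cutoff (E := (EuclideanSpace ℝ (Fin 3))) R) y y| ≤ 2 * K := by
  have hK0 : 0 ≤ K := by
    have h0 := (norm_nonneg _).trans (hK 0)
    exact (div_nonneg_iff.1 h0).elim (fun h => h.1) fun h => absurd h.2 (not_le.2 hR)
  by_cases hy : ‖y‖ ≤ 2 * R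
  · rw [← Real.norm_eq_abs]
    calc ‖fderiv ℝ (cutoff R) y y‖ ≤ ‖fderiv ℝ (cutoff R) y‖ * ‖y‖ :=
          ContinuousLinearMap.le_opNorm _ _
      _ ≤ K / R * (2 * R) := mul_le_mul (hK y) hy (norm_nonneg _) (div_nonneg hK0 hR.le)
      _ = 2 * K := by field_simp
  · have hts : y ∉ tsupport (cutoff (E := (EuclideanSpace ℝ (Fin 3))) R) := by
      intro hy'
      have hsub : tsupport (cutoff (E := (EuclideanSpace ℝ (Fin 3))) R) ⊆ Metric.closedBall (0 : (EuclideanSpace ℝ (Fin 3))) (2 * R) := by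
        refine closure_minimal (fun x hx => ?_) Metric.isClosed_closedBall
        rw [Metric.mem_closedBall, dist_zero_right]
        by_contra hxn
        exact hx (cutoff_eq_zero hR (not_le.1 hxn).le)
      have := hsub hy'
      rw [Metric.mem_closedBall, dist_zero_right] at this
      exact hy this
    rw [fderiv_of_notMem_tsupport ℝ hts]
    simp only [zero_apply, abs_zero]
    linarith

/-- **The dilution bonus** (route `HubbleDynamo`, item `DilutionBudget`, with the right-hand side
correctly bracketed): for a smooth Leray profile `−νΔU + aU + a(y·∇)U + (U·∇)U + ∇P = 0`,
`div U = 0` with Type-I tails `|U| ≤ C/(1+|y|)`, `|∇U| ≤ C/(1+|y|)²`, `|∇Ω| ≤ C/(1+|y|)³`,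
`∫ ⟪Ω, (Ω·∇)U⟫ = (a/2) ∫ |Ω|² + ν ∫ |∇Ω|²` — vortex stretching pays the Ohmic loss plus exactly
`a/2` of Hubble dilution. (The route decl `Theses.HubbleDynamo.DilutionBudget` as filed parses its
right-hand side as `(a/2) * ∫ y, (‖Ω y‖² + ν * ∫ |∇Ω|²)`, see the release note of
stmt-NavierStokesRegularity-1938; this theorem is the intended reading, hypotheses verbatim.) -/
theorem hubbleDynamo_dilutionBudget (ν a : ℝ) (U : (EuclideanSpace ℝ (Fin 3)) → (EuclideanSpace ℝ (Fin 3))) (P : (EuclideanSpace ℝ (Fin 3)) → ℝ)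
    (hU : ContDiff ℝ (⊤ : ℕ∞) U) (hP : ContDiff ℝ (⊤ : ℕ∞) P) (hprof : IsLerayProfile ν a U P)
    (hdec : ∃ C : ℝ, ∀ y, ‖U y‖ ≤ C / (1 + ‖y‖) ∧ ‖fderiv ℝ U y‖ ≤ C / (1 + ‖y‖) ^ 2 ∧
      ‖fderiv ℝ (curl U) y‖ ≤ C / (1 + ‖y‖) ^ 3) :
    ∫ y, ⟪curl U y, fderiv ℝ U y (curl U y)⟫ =
      (a / 2) * (∫ y, ‖curl U y‖ ^ 2) + ν * ∫ y, frobeniusNormSq (fderiv ℝ (curl U) y) := by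
  obtain ⟨C, hC⟩ := hdec
  have hU4 : ContDiff ℝ 4 U := hU.of_le (by norm_cast)
  have hP2 : ContDiff ℝ 2 P := hP.of_le (by norm_cast)
  obtain ⟨K, hK0, hK⟩ := exists_norm_fderiv_cutoff_le (E := (EuclideanSpace ℝ (Fin 3)))
  have hR : ∀ n : ℕ, (0 : ℝ) < (n : ℝ) + 1 := fun n => by positivity
  refine hubbleDilution_limit hU4 hP2 hprof hC (fun n => cutoff ((n : ℝ) + 1))
    (fun n => contDiff_cutoff _) (fun n => hasCompactSupport_cutoff (hR n))
    (fun n y => abs_cutoff_le_one _ _) (fun y => tendsto_cutoff_natCast_add_one y)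
    (K := 2 * K) (ε := fun n => K / ((n : ℝ) + 1)) (fun n y => hK _ (hR n) y) (fun n => ?_) ?_
    (fun n y => hubbleDilution_cutoff_fderiv_apply_self (hR n) (hK _ (hR n)) y)
  · calc K / ((n : ℝ) + 1) ≤ K := div_le_self hK0 (by linarith [(Nat.cast_nonneg n : (0 : ℝ) ≤ n)])
      _ ≤ 2 * K := by linarith
  · have h := tendsto_one_div_add_atTop_nhds_zero_nat.const_mul K
    rw [mul_zero] at h
    exact h.congr fun n => by ring

end Summit.NavierStokesRegularity.NavierStokesRegularity.Theorems

end
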